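import Mathlib
import HarnessLib
import Summits.Ventures.LatticeQCDFlow.Exactness.CenteredExponentialMomentVarianceFloor
import Summits.Ventures.LatticeQCDFlow.Exactness.SphereLOFlowEntropyFloorGerm

/-!
# The variance form of the extensive floor: block terms `≥ log(1 + (max 0 ((c²/2)s_j − ρ_j))²/(2 + 2|I_j|(κ²υ²/(d−1))c²))` — the constant `8` of the fluctuation form replaced by `2 + O(|I_j|c²)`

HONEST FRAMING: exact (Metropolis-corrected) sampling algorithms for lattice gauge theory;
figures of merit are autocorrelation/cost numbers at stated couplings and volumes; no
continuum-physics claim.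

Venture `LatticeQCDFlow` (cell pub-lqcd), topic `Exactness`; FANOUT row 7 (`s0-cpn-null`).  NEW WORK
of the cell over this lineage's `Exactness/SphereLOFlowEntropyFloorGerm.lean` (the floor with the
static germ, `(c²/2)s_j − ρ_j ≤ a_j`, `ρ_j = 2|I_j|(4|κ|³υ³/(d−1)²)c³`),
`Exactness/SphereLOFlowEntropyFloor.lean` (the exact-local floor
`Σ_j(∫h_j + log∫e^{−A_C h_j}) − tail ≤ KL`) and `Exactness/CenteredExponentialMomentVarianceFloor.lean`
(`log ∫e^{−(G−∫G)} ≥ log(1 + Var(G)/(2 + M))` for `G − ∫G ≤ M`); nothing is cited as a fact.  The point: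
the localized block action is SMALL, `|A_C h_j − ∫h_j| ≤ M_j = 2|I_j|·(κ²υ²/(d−1))·c²`, so the variance
form of the one-block floor applies with `2 + M_j` in place of the universal `8` of the mean-absolute-
deviation form, and `Var(A_C h_j) ≥ (max 0 ((c²/2)s_j − ρ_j))²` follows from the pointwise germ without
Jensen (`∫P² ≥ 2b∫|P| − b² ≥ b²` when `∫|P| ≥ b ≥ 0`).

## Content

* §1 `abs_loLocalTerm_le` (`|g_n| ≤ (κ²υ²/(d−1))·c²`), `sq_le_integral_sq_of_le_integral_abs`
  (`0 ≤ b ≤ ∫|P| ⇒ b² ≤ ∫P²`).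
* §2 **`log_one_add_div_le_blockTerm_of_le_variance`** — one block, any `0 ≤ x ≤ Var(A_C h_j)`:
  `log(1 + x/(2 + M_j)) ≤ ∫h_j + log∫e^{−A_C h_j}`, `M_j = 2|I_j|(κ²υ²/(d−1))c²`;
  **`log_one_add_sq_germ_div_le_blockTerm`** — with `x = (max 0 ((c²/2)s_j − ρ_j))²`.
* §3 **`sum_log_one_add_variance_germ_sub_le_klDiv_map_loFlow`** — THE FLOOR, variance form:
  `Σ_{j∈T} log(1 + (max 0 ((c²/2)s_j − ρ_j))²/(2 + 2|I_j|(κ²υ²/(d−1))c²)) − |Λ|·(12κ²υ²/(d−1))·c²·τ_m(c) ≤ KL`.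

NOT CLAIMED: a lower bound on `s_j`; numbers.
-/

noncomputable section

namespace Summit.Ventures.LatticeQCDFlow.Exactness

open Function Set Metric MeasureTheory NormedSpace InnerProductSpace InformationTheory
open scoped RealInnerProductSpace Topology Nat Classical

variable {Λ : Type*} {E : Type*} [NormedAddCommGroup E] [InnerProductSpace ℝ E]
  [FiniteDimensional ℝ E] [Fintype Λ] [DecidableEq Λ]

/-! ## §1 The localized block action is small; its variance dominates the squared germ -/

section Small

variable {U : Λ → Λ → (E →L[ℝ] E)} {T : ℝ}

/-- **`|g_n(ω)| ≤ (κ²υ²/(d−1))·c²`** for `0 ≤ c`: the localized site term integrates `u·v_n ∈ [0, u·(2κ²/(d−1))υ²]`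
over `[0, c]`. -/
theorem abs_loLocalTerm_le (hd : 2 ≤ Module.finrank ℝ E) (κ S₀ : ℝ) {υ : ℝ} (hυ : ∀ k, ∑ m, ‖U k m‖ ≤ υ)
    {e : Λ → E} (he : ∀ n, ‖e n‖ = 1) (m : ℕ) {c : ℝ} (hc0 : 0 ≤ c)
    {g : Λ → (Λ → sphere (0 : E) 1) → ℝ}
    (hg : ∀ n ω, g n ω = -∫ u in (0 : ℝ)..c, u * (2 * κ ^ 2 / ((Module.finrank ℝ E : ℝ) - 1) *
      ‖tangentKick (localField U n (sphereTDFlow (G := fun _ : ℝ => loFlowAction κ S₀ U)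
          (contDiff_const_family (contDiff_loFlowAction U κ S₀)) T 0 u
          ((nball (fun k => insert k (couplingNbhd U k)) (m + 1) n).piecewise
            (fun i => ((ω i : sphere (0 : E) 1) : E)) e)))
        (sphereTDFlow (G := fun _ : ℝ => loFlowAction κ S₀ U)
          (contDiff_const_family (contDiff_loFlowAction U κ S₀)) T 0 u
          ((nball (fun k => insert k (couplingNbhd U k)) (m + 1) n).piecewise
            (fun i => ((ω i : sphere (0 : E) 1) : E)) e) n)‖ ^ 2))
    (n : Λ) (ω : Λ → sphere (0 : E) 1) :
    |g n ω| ≤ κ ^ 2 * υ ^ 2 / ((Module.finrank ℝ E : ℝ) - 1) * c ^ 2 := by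
  set N : Λ → Set Λ := fun k => insert k (couplingNbhd U k) with hN
  set z : Λ → E := (nball N (m + 1) n).piecewise (fun i => ((ω i : sphere (0 : E) 1) : E)) e with hzdef
  have hz : ∀ k, ‖z k‖ = 1 := by
    intro k
    by_cases hk : k ∈ nball N (m + 1) n
    · simp only [hzdef]; rw [Set.piecewise_eq_of_mem _ _ _ hk]; exact norm_sphereConfig_eq_one ω k
    · simp only [hzdef]; rw [Set.piecewise_eq_of_notMem _ _ _ hk]; exact he k
  have hd1 : (0 : ℝ) < (Module.finrank ℝ E : ℝ) - 1 := by
    have : (2 : ℝ) ≤ Module.finrank ℝ E := by exact_mod_cast hd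
    linarith
  set w : ℝ → ℝ := fun u => 2 * κ ^ 2 / ((Module.finrank ℝ E : ℝ) - 1) *
    ‖tangentKick (localField U n (sphereTDFlow (G := fun _ : ℝ => loFlowAction κ S₀ U)
      (contDiff_const_family (contDiff_loFlowAction U κ S₀)) T 0 u z))
      (sphereTDFlow (G := fun _ : ℝ => loFlowAction κ S₀ U)
        (contDiff_const_family (contDiff_loFlowAction U κ S₀)) T 0 u z n)‖ ^ 2 with hw
  have hwc : Continuous w := continuous_loCarreSite_loFlow (U := U) κ S₀ n z (T := T)
  have hwb : ∀ u, 0 ≤ w u ∧ w u ≤ 2 * κ ^ 2 / ((Module.finrank ℝ E : ℝ) - 1) * υ ^ 2 := by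
    intro u
    have h1 : ∀ k, ‖sphereTDFlow (G := fun _ : ℝ => loFlowAction κ S₀ U)
        (contDiff_const_family (contDiff_loFlowAction U κ S₀)) T 0 u z k‖ = 1 :=
      fun k => norm_sphereTDFlow_eq_one _ 0 hz u k
    have hp := norm_tangentKick_localField_le U h1 n
    have hpυ := hp.trans (hυ n)
    have hc' : 0 ≤ 2 * κ ^ 2 / ((Module.finrank ℝ E : ℝ) - 1) := div_nonneg (by positivity) hd1.le
    refine ⟨mul_nonneg hc' (sq_nonneg _), mul_le_mul_of_nonneg_left ?_ hc'⟩
    exact pow_le_pow_left₀ (norm_nonneg _) hpυ 2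
  have hgn : g n ω = -∫ u in (0 : ℝ)..c, u * w u := hg n ω
  rw [hgn, abs_neg]
  have hi : IntervalIntegrable (fun u => u * w u) volume 0 c := (continuous_id.mul hwc).intervalIntegrable _ _
  have hnn : 0 ≤ ∫ u in (0 : ℝ)..c, u * w u :=
    intervalIntegral.integral_nonneg hc0 fun u hu => mul_nonneg hu.1 (hwb u).1
  rw [abs_of_nonneg hnn]
  have hmono : ∫ u in (0 : ℝ)..c, u * w u ≤
      ∫ u in (0 : ℝ)..c, u * (2 * κ ^ 2 / ((Module.finrank ℝ E : ℝ) - 1) * υ ^ 2) := by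
    refine intervalIntegral.integral_mono_on hc0 hi ((continuous_id.mul continuous_const).intervalIntegrable _ _)
      fun u hu => mul_le_mul_of_nonneg_left (hwb u).2 hu.1
  have hval : ∫ u in (0 : ℝ)..c, u * (2 * κ ^ 2 / ((Module.finrank ℝ E : ℝ) - 1) * υ ^ 2) =
      κ ^ 2 * υ ^ 2 / ((Module.finrank ℝ E : ℝ) - 1) * c ^ 2 := by
    rw [intervalIntegral.integral_mul_const, integral_id]; ring
  linarith

omit [FiniteDimensional ℝ E] [Fintype Λ] [DecidableEq Λ] in
/-- `0 ≤ b ≤ ∫|P| dP ⇒ b² ≤ ∫P² dP` on a probability space (from `(|P| − b)² ≥ 0`; no Jensen needed). -/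
theorem sq_le_integral_sq_of_le_integral_abs {Ω : Type*} [MeasurableSpace Ω] {P : Measure Ω}
    [IsProbabilityMeasure P] {f : Ω → ℝ} (hf : Integrable f P) (hf2 : Integrable (fun ω => f ω ^ 2) P)
    {b : ℝ} (hb : 0 ≤ b) (hbf : b ≤ ∫ ω, |f ω| ∂P) : b ^ 2 ≤ ∫ ω, f ω ^ 2 ∂P := by
  have hi : Integrable (fun ω => 2 * b * |f ω| - b ^ 2) P := (hf.abs.const_mul _).sub (integrable_const _)
  have hpt : ∀ ω, 2 * b * |f ω| - b ^ 2 ≤ f ω ^ 2 := fun ω => by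
    nlinarith [sq_nonneg (|f ω| - b), sq_abs (f ω)]
  have hmono := integral_mono hi hf2 hpt
  have hA : Integrable (fun ω => 2 * b * |f ω|) P := hf.abs.const_mul _
  have hB : Integrable (fun _ : Ω => b ^ 2) P := integrable_const _
  rw [integral_sub hA hB, integral_const_mul, integral_const, smul_eq_mul, probReal_univ, one_mul] at hmono
  nlinarith

end Small

/-! ## §2 The variance form of the floor -/

section Floor

variable [MeasurableSpace E] [BorelSpace E] [Nontrivial E] {U : Λ → Λ → (E →L[ℝ] E)} {T : ℝ}

/-- **ONE BLOCK, variance form (abstract lower bound)**: for a finite index set `I`, the localized block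
term `h = Σ_{n∈I} g_n`, any corridor set `C` (`0 ≤ c`), `M = 2|I|(κ²υ²/(d−1))c²`, and any
`0 ≤ x ≤ Var(A_C h)`:  `log(1 + x/(2 + M)) ≤ ∫h dπ̄ + log ∫e^{−A_C h} dπ̄` (the localized block action is
small, `|A_C h − ∫h| ≤ M`, so the variance form of the one-block floor applies). -/
theorem log_one_add_div_le_blockTerm_of_le_variance (hd : 2 ≤ Module.finrank ℝ E)
    (κ S₀ : ℝ) {υ : ℝ} (hυ : ∀ k, ∑ m, ‖U k m‖ ≤ υ) {e : Λ → E} (he : ∀ n, ‖e n‖ = 1) (m : ℕ)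
    {c : ℝ} (hc0 : 0 ≤ c)
    {g : Λ → (Λ → sphere (0 : E) 1) → ℝ}
    (hg : ∀ n ω, g n ω = -∫ u in (0 : ℝ)..c, u * (2 * κ ^ 2 / ((Module.finrank ℝ E : ℝ) - 1) *
      ‖tangentKick (localField U n (sphereTDFlow (G := fun _ : ℝ => loFlowAction κ S₀ U)
          (contDiff_const_family (contDiff_loFlowAction U κ S₀)) T 0 u
          ((nball (fun k => insert k (couplingNbhd U k)) (m + 1) n).piecewise
            (fun i => ((ω i : sphere (0 : E) 1) : E)) e)))
        (sphereTDFlow (G := fun _ : ℝ => loFlowAction κ S₀ U)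
          (contDiff_const_family (contDiff_loFlowAction U κ S₀)) T 0 u
          ((nball (fun k => insert k (couplingNbhd U k)) (m + 1) n).piecewise
            (fun i => ((ω i : sphere (0 : E) 1) : E)) e) n)‖ ^ 2))
    (I C : Finset Λ) {x : ℝ} (hx0 : 0 ≤ x)
    (hx : x ≤ ∫ ω, (coordAvg (uniformSphere (volume : Measure E)) C (fun ω => ∑ n ∈ I, g n ω) ω -
        ∫ ω', (∑ n ∈ I, g n ω') ∂Measure.pi (fun _ : Λ => uniformSphere (volume : Measure E))) ^ 2
        ∂Measure.pi (fun _ : Λ => uniformSphere (volume : Measure E))) :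
    Real.log (1 + x / (2 + 2 * (I.card * (κ ^ 2 * υ ^ 2 / ((Module.finrank ℝ E : ℝ) - 1) * c ^ 2)))) ≤
      (∫ ω, (∑ n ∈ I, g n ω) ∂Measure.pi (fun _ : Λ => uniformSphere (volume : Measure E))) +
        Real.log (∫ ω, Real.exp (-coordAvg (uniformSphere (volume : Measure E)) C (fun ω => ∑ n ∈ I, g n ω) ω)
          ∂Measure.pi (fun _ : Λ => uniformSphere (volume : Measure E))) := by
  set μ : Measure (Λ → sphere (0 : E) 1) := Measure.pi (fun _ : Λ => uniformSphere (volume : Measure E))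
    with hμ
  set h : (Λ → sphere (0 : E) 1) → ℝ := fun ω => ∑ n ∈ I, g n ω with hh
  set A : (Λ → sphere (0 : E) 1) → ℝ := coordAvg (uniformSphere (volume : Measure E)) C h with hA
  set M : ℝ := 2 * (I.card * (κ ^ 2 * υ ^ 2 / ((Module.finrank ℝ E : ℝ) - 1) * c ^ 2)) with hM
  have hd1 : (0 : ℝ) < (Module.finrank ℝ E : ℝ) - 1 := by
    have : (2 : ℝ) ≤ Module.finrank ℝ E := by exact_mod_cast hd
    linarith
  have hgc : ∀ n, Continuous (g n) := continuous_loLocalTerm (U := U) κ S₀ e m c hg (T := T)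
  have hhc : Continuous h := continuous_finsetSum _ fun n _ => hgc n
  have hAc : Continuous A := continuous_coordAvg _ C hhc
  have hM0 : 0 ≤ M := by rw [hM]; exact mul_nonneg (by norm_num) (mul_nonneg (Nat.cast_nonneg _)
    (mul_nonneg (div_nonneg (by positivity) hd1.le) (sq_nonneg c)))
  -- the localized block action is small: `|h| ≤ M/2`, `|A| ≤ M/2`, `|∫A| ≤ M/2`
  have hhb : ∀ ω, |h ω| ≤ M / 2 := by
    intro ω
    refine (Finset.abs_sum_le_sum_abs _ _).trans ?_
    calc ∑ n ∈ I, |g n ω| ≤ ∑ _n ∈ I, κ ^ 2 * υ ^ 2 / ((Module.finrank ℝ E : ℝ) - 1) * c ^ 2 :=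
          Finset.sum_le_sum fun n _ => abs_loLocalTerm_le hd κ S₀ hυ he m hc0 hg n ω (T := T)
      _ = M / 2 := by rw [Finset.sum_const, nsmul_eq_mul, hM]; ring
  have hAb : ∀ ω, |A ω| ≤ M / 2 := fun ω => abs_coordAvg_le_of_abs_le _ C hhb ω
  have hmean : ∫ ω, A ω ∂μ = ∫ ω, h ω ∂μ := integral_coordAvg _ C hhc
  have hmb : |∫ ω, A ω ∂μ| ≤ M / 2 := by
    have hm := norm_integral_le_of_norm_le_const (μ := μ) (f := A) (C := M / 2)
      (ae_of_all _ fun ω => by rw [Real.norm_eq_abs]; exact hAb ω)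
    rwa [hμ, probReal_univ, mul_one, Real.norm_eq_abs, ← hμ] at hm
  have hGM : ∀ ω, A ω - ∫ ω', A ω' ∂μ ≤ M := by
    intro ω
    have h1 := (abs_sub (A ω) (∫ ω', A ω' ∂μ)).trans (add_le_add (hAb ω) hmb)
    linarith [le_abs_self (A ω - ∫ ω', A ω' ∂μ)]
  -- the variance form of the one-block floor
  have hAi : Integrable A μ := integrable_pi_of_continuous _ hAc
  have hA2 : Integrable (fun ω => A ω ^ 2) μ := integrable_pi_of_continuous _ (hAc.pow 2)
  have hAe : Integrable (fun ω => Real.exp (-A ω)) μ := integrable_pi_of_continuous _ (Real.continuous_exp.comp hAc.neg)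
  have hR := log_one_add_variance_div_le_log_integral_exp_neg_sub_mean (P := μ) hAi hA2 hAe hM0 hGM
  have heq := integral_add_log_integral_exp_neg_eq (uniformSphere (volume : Measure E)) hAc
  rw [← hμ] at heq
  rw [hmean] at hR heq
  have hstep : Real.log (1 + x / (2 + M)) ≤ Real.log (1 + (∫ ω, (A ω - ∫ ω', h ω' ∂μ) ^ 2 ∂μ) / (2 + M)) := by
    have h2M : 0 < 2 + M := by linarith
    apply Real.log_le_log (by positivity)
    have hx' : x ≤ ∫ ω, (A ω - ∫ ω', h ω' ∂μ) ^ 2 ∂μ := by simpa [hA, hh] using hx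
    have := div_le_div_of_nonneg_right hx' h2M.le
    linarith
  have hfin := hstep.trans hR
  rw [← heq] at hfin
  simpa [hM, hA, hh] using hfin

set_option maxHeartbeats 400000 in
/-- **ONE BLOCK, variance form (static germ)**: for a finite index set `I`, the localized block term
`h = Σ_{n∈I} g_n`, the static block term `V = Σ_{n∈I} v_n` and any corridor set `C` (`0 ≤ c ≤ |T| + 1`),
with `b = (c²/2)·∫|A_C V − ∫V| − 2|I|(4|κ|³υ³/(d−1)²)c³` and `M = 2|I|(κ²υ²/(d−1))c²`:
`log(1 + (max 0 b)²/(2 + M)) ≤ ∫h dπ̄ + log ∫e^{−A_C h} dπ̄`. -/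
theorem log_one_add_sq_germ_div_le_blockTerm (hU0 : ∀ n, U n n = 0)
    (hUadj : ∀ m n (v w : E), ⟪U m n v, w⟫ = ⟪v, U n m w⟫) (hd : 2 ≤ Module.finrank ℝ E)
    (κ S₀ : ℝ) {υ : ℝ} (hυ : ∀ k, ∑ m, ‖U k m‖ ≤ υ) {e : Λ → E} (he : ∀ n, ‖e n‖ = 1) (m : ℕ)
    {c : ℝ} (hc0 : 0 ≤ c) (hc : c ≤ |T| + 1)
    {g : Λ → (Λ → sphere (0 : E) 1) → ℝ}
    (hg : ∀ n ω, g n ω = -∫ u in (0 : ℝ)..c, u * (2 * κ ^ 2 / ((Module.finrank ℝ E : ℝ) - 1) *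
      ‖tangentKick (localField U n (sphereTDFlow (G := fun _ : ℝ => loFlowAction κ S₀ U)
          (contDiff_const_family (contDiff_loFlowAction U κ S₀)) T 0 u
          ((nball (fun k => insert k (couplingNbhd U k)) (m + 1) n).piecewise
            (fun i => ((ω i : sphere (0 : E) 1) : E)) e)))
        (sphereTDFlow (G := fun _ : ℝ => loFlowAction κ S₀ U)
          (contDiff_const_family (contDiff_loFlowAction U κ S₀)) T 0 u
          ((nball (fun k => insert k (couplingNbhd U k)) (m + 1) n).piecewise
            (fun i => ((ω i : sphere (0 : E) 1) : E)) e) n)‖ ^ 2))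
    (I C : Finset Λ) :
    Real.log (1 + (max 0 (c ^ 2 / 2 * (∫ ω, |coordAvg (uniformSphere (volume : Measure E)) C (fun ω => ∑ n ∈ I,
          2 * κ ^ 2 / ((Module.finrank ℝ E : ℝ) - 1) *
            ‖tangentKick (localField U n (fun i => ((ω i : sphere (0 : E) 1) : E))) (ω n : E)‖ ^ 2) ω -
          ∫ ω', (∑ n ∈ I, 2 * κ ^ 2 / ((Module.finrank ℝ E : ℝ) - 1) *
            ‖tangentKick (localField U n (fun i => ((ω' i : sphere (0 : E) 1) : E))) (ω' n : E)‖ ^ 2)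
            ∂Measure.pi (fun _ : Λ => uniformSphere (volume : Measure E))|
          ∂Measure.pi (fun _ : Λ => uniformSphere (volume : Measure E))) -
        2 * (I.card * (4 * |κ| ^ 3 * υ ^ 3 / ((Module.finrank ℝ E : ℝ) - 1) ^ 2 * c ^ 3)))) ^ 2 /
        (2 + 2 * (I.card * (κ ^ 2 * υ ^ 2 / ((Module.finrank ℝ E : ℝ) - 1) * c ^ 2)))) ≤
      (∫ ω, (∑ n ∈ I, g n ω) ∂Measure.pi (fun _ : Λ => uniformSphere (volume : Measure E))) +
        Real.log (∫ ω, Real.exp (-coordAvg (uniformSphere (volume : Measure E)) C (fun ω => ∑ n ∈ I, g n ω) ω)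
          ∂Measure.pi (fun _ : Λ => uniformSphere (volume : Measure E))) := by
  set μ : Measure (Λ → sphere (0 : E) 1) := Measure.pi (fun _ : Λ => uniformSphere (volume : Measure E))
    with hμ
  set h : (Λ → sphere (0 : E) 1) → ℝ := fun ω => ∑ n ∈ I, g n ω with hh
  set A : (Λ → sphere (0 : E) 1) → ℝ := coordAvg (uniformSphere (volume : Measure E)) C h with hA
  have hgc : ∀ n, Continuous (g n) := continuous_loLocalTerm (U := U) κ S₀ e m c hg (T := T)
  have hhc : Continuous h := continuous_finsetSum _ fun n _ => hgc n
  have hAc : Continuous A := continuous_coordAvg _ C hhc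
  -- the squared germ is below the variance
  have hgerm := germ_le_blockFluctuation hU0 hUadj hd κ S₀ hυ he m hc0 hc hg I C (T := T)
  rw [← hμ] at hgerm
  set b : ℝ := c ^ 2 / 2 * (∫ ω, |coordAvg (uniformSphere (volume : Measure E)) C (fun ω => ∑ n ∈ I,
          2 * κ ^ 2 / ((Module.finrank ℝ E : ℝ) - 1) *
            ‖tangentKick (localField U n (fun i => ((ω i : sphere (0 : E) 1) : E))) (ω n : E)‖ ^ 2) ω -
          ∫ ω', (∑ n ∈ I, 2 * κ ^ 2 / ((Module.finrank ℝ E : ℝ) - 1) *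
            ‖tangentKick (localField U n (fun i => ((ω' i : sphere (0 : E) 1) : E))) (ω' n : E)‖ ^ 2) ∂μ| ∂μ) -
        2 * (I.card * (4 * |κ| ^ 3 * υ ^ 3 / ((Module.finrank ℝ E : ℝ) - 1) ^ 2 * c ^ 3)) with hb
  have hPi : Integrable (fun ω => A ω - ∫ ω', h ω' ∂μ) μ :=
    (integrable_pi_of_continuous _ hAc).sub (integrable_const _)
  have hP2 : Integrable (fun ω => (A ω - ∫ ω', h ω' ∂μ) ^ 2) μ :=
    integrable_pi_of_continuous _ ((hAc.sub continuous_const).pow 2)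
  have hvar : (max 0 b) ^ 2 ≤ ∫ ω, (A ω - ∫ ω', h ω' ∂μ) ^ 2 ∂μ := by
    rcases le_or_gt b 0 with hb0 | hb0
    · rw [max_eq_left hb0]; simpa using integral_nonneg fun ω => sq_nonneg (A ω - ∫ ω', h ω' ∂μ)
    · rw [max_eq_right hb0.le]
      exact sq_le_integral_sq_of_le_integral_abs hPi hP2 hb0.le (by simpa [hA, hh] using hgerm)
  have hmain := log_one_add_div_le_blockTerm_of_le_variance hd κ S₀ hυ he m hc0 hg I C (sq_nonneg (max 0 b))
    (by simpa [hA, hh, hμ] using hvar) (T := T)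
  simpa [hb, hμ] using hmain

set_option maxHeartbeats 400000 in
/-- **THE EXTENSIVE FLOOR, variance form.**  In the setting of `sum_blocks_sub_le_klDiv_map_loFlow`
(blocks `B_j`, `j ∈ T`, pairwise disjoint and separated for the radius-`(m+1)` balls; corridors
`C = Λ ∖ ⋃_j B_j`; `I_j = {n : ball(n) meets B_j}`; static block terms `V_j = Σ_{n∈I_j} v_n`,
`s_j = ∫|A_C V_j − ∫V_j dπ̄| dπ̄`):
`Σ_{j∈T} log(1 + (max 0 ((c²/2)s_j − 2|I_j|(4|κ|³υ³/(d−1)²)c³))²/(2 + 2|I_j|(κ²υ²/(d−1))c²))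
  − |Λ|·(12κ²υ²/(d−1))·c²·τ_m(c) ≤ KL((Φ_{0→c})_*π̄ ‖ e^{−cS}π̄/Z_c)`. -/
theorem sum_log_one_add_variance_germ_sub_le_klDiv_map_loFlow (hU0 : ∀ n, U n n = 0)
    (hUadj : ∀ m n (v w : E), ⟪U m n v, w⟫ = ⟪v, U n m w⟫) (hd : 2 ≤ Module.finrank ℝ E)
    (κ S₀ : ℝ) {υ : ℝ} (hυ : ∀ k, ∑ m, ‖U k m‖ ≤ υ) {c : ℝ} (hc0 : 0 ≤ c) (hc : c ≤ |T| + 1)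
    {e : Λ → E} (he : ∀ n, ‖e n‖ = 1) (m : ℕ)
    {g : Λ → (Λ → sphere (0 : E) 1) → ℝ}
    (hg : ∀ n ω, g n ω = -∫ u in (0 : ℝ)..c, u * (2 * κ ^ 2 / ((Module.finrank ℝ E : ℝ) - 1) *
      ‖tangentKick (localField U n (sphereTDFlow (G := fun _ : ℝ => loFlowAction κ S₀ U)
          (contDiff_const_family (contDiff_loFlowAction U κ S₀)) T 0 u
          ((nball (fun k => insert k (couplingNbhd U k)) (m + 1) n).piecewise
            (fun i => ((ω i : sphere (0 : E) 1) : E)) e)))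
        (sphereTDFlow (G := fun _ : ℝ => loFlowAction κ S₀ U)
          (contDiff_const_family (contDiff_loFlowAction U κ S₀)) T 0 u
          ((nball (fun k => insert k (couplingNbhd U k)) (m + 1) n).piecewise
            (fun i => ((ω i : sphere (0 : E) 1) : E)) e) n)‖ ^ 2))
    {J : Type*} (Tb : Finset J) (B : J → Finset Λ)
    (hB : ∀ j ∈ Tb, ∀ j' ∈ Tb, j ≠ j' → Disjoint (B j) (B j'))
    (hsep : ∀ n, ∀ j ∈ Tb, ∀ j' ∈ Tb,
      ¬ Disjoint (nball (fun k => insert k (couplingNbhd U k)) (m + 1) n) ↑(B j) →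
      ¬ Disjoint (nball (fun k => insert k (couplingNbhd U k)) (m + 1) n) ↑(B j') → j = j') :
    ∑ j ∈ Tb, Real.log (1 + (max 0 (c ^ 2 / 2 *
        (∫ ω, |coordAvg (uniformSphere (volume : Measure E)) (Finset.univ \ Tb.biUnion B)
          (fun ω => ∑ n ∈ Finset.univ.filter (fun n =>
            ¬ Disjoint (nball (fun k => insert k (couplingNbhd U k)) (m + 1) n) ↑(B j)),
            2 * κ ^ 2 / ((Module.finrank ℝ E : ℝ) - 1) *
              ‖tangentKick (localField U n (fun i => ((ω i : sphere (0 : E) 1) : E))) (ω n : E)‖ ^ 2) ω -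
          ∫ ω', (∑ n ∈ Finset.univ.filter (fun n =>
            ¬ Disjoint (nball (fun k => insert k (couplingNbhd U k)) (m + 1) n) ↑(B j)),
            2 * κ ^ 2 / ((Module.finrank ℝ E : ℝ) - 1) *
              ‖tangentKick (localField U n (fun i => ((ω' i : sphere (0 : E) 1) : E))) (ω' n : E)‖ ^ 2)
            ∂Measure.pi (fun _ : Λ => uniformSphere (volume : Measure E))|
          ∂Measure.pi (fun _ : Λ => uniformSphere (volume : Measure E))) -
        2 * ((Finset.univ.filter (fun n =>
            ¬ Disjoint (nball (fun k => insert k (couplingNbhd U k)) (m + 1) n) ↑(B j))).card *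
          (4 * |κ| ^ 3 * υ ^ 3 / ((Module.finrank ℝ E : ℝ) - 1) ^ 2 * c ^ 3)))) ^ 2 /
        (2 + 2 * ((Finset.univ.filter (fun n =>
            ¬ Disjoint (nball (fun k => insert k (couplingNbhd U k)) (m + 1) n) ↑(B j))).card *
          (κ ^ 2 * υ ^ 2 / ((Module.finrank ℝ E : ℝ) - 1) * c ^ 2)))) -
      Fintype.card Λ * (12 * κ ^ 2 * υ ^ 2 / ((Module.finrank ℝ E : ℝ) - 1) * c ^ 2 *
        (2 * Real.exp (3 * |κ| * υ / ((Module.finrank ℝ E : ℝ) - 1) * c) *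
          (3 * |κ| * υ / ((Module.finrank ℝ E : ℝ) - 1) * c) ^ (m + 1) / ((m + 1)! : ℝ))) ≤
      (klDiv (Measure.map (sphereTDFlowMap (G := fun _ : ℝ => loFlowAction κ S₀ U)
          (contDiff_const_family (contDiff_loFlowAction U κ S₀)) T 0 c)
          (Measure.pi (fun _ : Λ => uniformSphere (volume : Measure E))))
        ((Measure.pi (fun _ : Λ => uniformSphere (volume : Measure E))).tilted
          fun ω => -(c * esAction κ S₀ U (fun m => (ω m : E))))).toReal := by
  refine le_trans ?_
    (sum_blocks_sub_le_klDiv_map_loFlow hU0 hUadj hd κ S₀ hυ hc0 hc he m hg Tb B hB hsep (T := T))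
  gcongr with j hj
  exact log_one_add_sq_germ_div_le_blockTerm hU0 hUadj hd κ S₀ hυ he m hc0 hc hg _ _ (T := T)

end Floor

end Summit.Ventures.LatticeQCDFlow.Exactness

end
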